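import Literature.NumberTheory.GaloisRepresentations.HilbertNinetySubgroup
import Literature.NumberTheory.GaloisRepresentations.GaloisCohomologyKummerProofs
import HarnessLib

/-!
# Kummer theory for the closed subgroups `Gal(K̄/F) ≤ Γ_k` (Serre, *Local Fields* X §3 b); NSW (8.3.x) input)

For a field `k` with algebraic closure `K̄` and absolute Galois group `Γ_k`, and a subextension
`F ⊆ K̄` of `k`, the fixing subgroup `Gal(K̄/F) = galFixing k F ≤ Γ_k` (subspace topology) is the
absolute Galois group of `F` realised inside `Γ_k`.  Hilbert's Theorem 90 for it is the tree's
`subsingleton_one_units_galFixing` (`HilbertNinetySubgroup.lean`, Serre X §1 Prop. 2 transported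
along `galFixingOfAlgEquiv : Aut_F(K̄) → Gal(K̄/F)`).  This file records the consequence
**Kummer theory for `Gal(K̄/F)`** in the three currencies in which the tree consumes it:

* §1 `galFixing.exists_eq_smul_div_of_cocycle` — Hilbert 90 at FUNCTION level: a multiplicative
  `1`-cocycle `c : Gal(K̄/F) → K̄ˣ`, `c (g h) = c g · g(c h)`, with open kernel-set `{g | c g = 1}`
  (e.g. locally constant, `…_of_isLocallyConstant`) is `g ↦ g(β)/β` for some `β ∈ K̄ˣ`;
* §2 `galFixing.exists_kummer_of_cocycle` — if moreover `cⁿ = 1` (a cocycle with values in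
  `μₙ(K̄)`), then `βⁿ` is `Gal(K̄/F)`-invariant; and `galFixing.exists_algebraMap_eq_of_forall_smul_eq`
  — an element of `K̄` fixed by `Gal(K̄/F)` lies in `F` (characteristic `0`; in exponential
  characteristic `q` a `q`-power does, `…_pow_…`, the fixed field of `Aut_F(K̄)` being the perfect
  closure of `F`), so `βⁿ ∈ F`: "`Fˣ/Fˣⁿ ⥲ H¹(Gal(K̄/F), μₙ)`, every class is `g ↦ g(ⁿ√b)/ⁿ√b`";
* §3 `galFixing.exists_kummer_eq_contOneCocycle` — the same for the tree's bundled continuous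
  `1`-cocycles of the RESTRICTED Kummer module `(mu k n).restrict (subgroupIncl (galFixing k F))`
  (the currency of `KummerSES` / `IsSES.res` and of `subsingleton_one_units_galFixing`);
* §4 `galFixing.exists_kummer_of_hom` — the trivial-action case `μₙ(K̄) ⊆ F`: every continuous
  (open-kernel) homomorphism `χ : Gal(K̄/F) → μₙ` is `g ↦ g(β)/β` with `βⁿ ∈ F`
  ("`Hom_cont(Gal(K̄/F), μₙ) = H¹(F, μₙ) = Fˣ/Fˣⁿ`");
* §5 closed subgroups: for `K̄/k` Galois (e.g. `k` of characteristic `0`) every CLOSED subgroup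
  `H ≤ Γ_k` is `galFixing k (K̄^H)` (Krull, Mathlib `InfiniteGalois.fixingSubgroup_fixedField`;
  `exists_eq_galFixing_of_isClosed`), so §1–§4 apply verbatim to `H` — in particular to the
  ramification subgroup `N_S = Gal(K̄/K_S)` of a number field (`RestrictedRamification.lean`), the
  reading used for `H¹(Gal(K̄/K_S), μ_{p^m}) = K_Sˣ/K_Sˣ^{p^m}` in the inflation–restriction analysis of
  `H²(G_S, μ_{p^m})` (Neukirch–Schmidt–Wingberg (8.3.x)); `exists_kummer_of_hom_of_isClosed`,
  `exists_kummer_of_cocycle_of_isClosed`.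

Proof files only: theorems, no definition, no named fact, no instance.  The absolute case
`F = k` is `GaloisCohomologyKummerProofs.lean` / `GaloisCohomologyKummerCocycles.lean`
(`kummerMap_surjective`, `exists_kummerOneCocycle_eq`), whose pattern (Serre's Poincaré-series
Hilbert 90 `AlgEquiv.exists_smul_div_eq_of_isOpen` + descent of `Aut`-fixed elements
`exists_pow_mem_range_of_forall_algEquiv`) is followed here over `F`.

## What is NOT here
No statement about non-closed subgroups; no identification of cohomology GROUPS (only the
cocycle-level surjectivity statements the consumers use); no `n = 0` junk analysis (for `n = 0`
the torsion hypothesis `c g ^ 0 = 1` is vacuous and §2–§4 degenerate to §1, consistently).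

## References
* [SerreLocalFields1979] J.-P. Serre, *Local Fields* (GTM 67, 1979), Ch. X §1 Prop. 2 (Hilbert 90
  for infinite Galois extensions), §3 b) (Kummer theory: `H¹(G(K_s/K), μₙ) = K*/K*ⁿ`).
* [SerreGaloisCohomology1997] J.-P. Serre, *Galois Cohomology* (1997), II §1.2 Prop. 1 and Cor.
* [NeukirchSchmidtWingberg2008] J. Neukirch, A. Schmidt, K. Wingberg, *Cohomology of Number
  Fields*, 2nd ed., VIII §3 (the groups `G_S`, `𝒪_Sˣ`-Kummer theory).
-/

noncomputable section

open Topology Filter IntermediateField Field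

universe u

namespace Literature.NumberTheory.GaloisRepresentations

open LocalWeilDatum DiscreteGaloisModule

variable {k : Type u} [Field k]

/-! ### §1. Hilbert 90 for `Gal(K̄/F)` at function level -/

section HilbertNinetyFun

variable (F : IntermediateField k (AlgebraicClosure k))

/-- **Hilbert 90 for `Gal(K̄/F) ≤ Γ_k`, cocycle level.**  A multiplicative `1`-cocycle
`c : Gal(K̄/F) → K̄ˣ`, `c (g h) = c g · g • c h`, whose kernel-set `{g | c g = 1}` is open (subspace
topology of the Krull topology) is a coboundary: `c g = g • β / β` for some `β ∈ K̄ˣ`.  Proof: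
transport along the continuous surjection `galFixingOfAlgEquiv F : Aut_F(K̄) → Gal(K̄/F)` and apply
Serre's Poincaré-series Hilbert 90 for the normal extension `K̄/F`
(`AlgEquiv.exists_smul_div_eq_of_isOpen`), exactly as in `subsingleton_one_units_galFixing`.
[cite: SerreLocalFields1979, X §1 Prop. 2] -/
theorem galFixing.exists_eq_smul_div_of_cocycle (c : galFixing k F → (AlgebraicClosure k)ˣ)
    (hcoc : ∀ g h, c (g * h) = c g * (g : absoluteGaloisGroup k) • c h)
    (hopen : IsOpen {g | c g = 1}) :
    ∃ β : (AlgebraicClosure k)ˣ, ∀ g, c g = (g : absoluteGaloisGroup k) • β / β := by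
  classical
  haveI := normal_algebraicClosure_intermediateField F
  let j := galFixingOfAlgEquiv F
  let f : (AlgebraicClosure k ≃ₐ[F] AlgebraicClosure k) → (AlgebraicClosure k)ˣ := fun τ => c (j τ)
  have hsmul : ∀ (τ : AlgebraicClosure k ≃ₐ[F] AlgebraicClosure k) (x : (AlgebraicClosure k)ˣ),
      τ • x = ((j τ : galFixing k F) : absoluteGaloisGroup k) • x := fun τ x => Units.ext rfl
  have hf : ∀ g h, f (g * h) = g • f h * f g := by
    intro g h
    change c (j (g * h)) = _
    rw [map_mul, hcoc, hsmul, mul_comm]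
  have hopen' : IsOpen {τ | f τ = 1} := hopen.preimage (continuous_galFixingOfAlgEquiv F)
  obtain ⟨x, hx⟩ := AlgEquiv.exists_smul_div_eq_of_isOpen f hf hopen'
  refine ⟨x, fun g => ?_⟩
  obtain ⟨τ, rfl⟩ := galFixingOfAlgEquiv_surjective F g
  change f τ = ((j τ : galFixing k F) : absoluteGaloisGroup k) • x / x
  rw [← hsmul]
  exact (hx τ).symm

/-- Hilbert 90 for `Gal(K̄/F)`, locally constant cocycles (= continuous for the discrete topology on
`K̄ˣ`): `c g = g • β / β`. [cite: SerreLocalFields1979, X §1 Prop. 2] -/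
theorem galFixing.exists_eq_smul_div_of_isLocallyConstant
    (c : galFixing k F → (AlgebraicClosure k)ˣ) (hc : IsLocallyConstant c)
    (hcoc : ∀ g h, c (g * h) = c g * (g : absoluteGaloisGroup k) • c h) :
    ∃ β : (AlgebraicClosure k)ˣ, ∀ g, c g = (g : absoluteGaloisGroup k) • β / β :=
  galFixing.exists_eq_smul_div_of_cocycle F c hcoc (hc.isOpen_fiber 1)

end HilbertNinetyFun

/-! ### §2. Kummer cocycles of `Gal(K̄/F)` and descent of `βⁿ` to `F` -/

section Kummer

variable (F : IntermediateField k (AlgebraicClosure k))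

/-- An element of `K̄` fixed by `Gal(K̄/F)` has a `q`-power-th power in `F` (`q` the exponential
characteristic): the fixed field of `Aut_F(K̄)` is the perfect closure of `F` in `K̄`
(`exists_pow_mem_range_of_forall_algEquiv` over `F`, `K̄/F` normal).
[cite: MilneFT2022, Ch. 3 (fixed field of Aut of a normal extension = perfect closure) and Ch. 7] -/
theorem galFixing.exists_algebraMap_eq_pow_of_forall_smul_eq (q : ℕ) [ExpChar k q]
    {x : AlgebraicClosure k} (hx : ∀ g : galFixing k F, (g : absoluteGaloisGroup k) • x = x) :
    ∃ (m : ℕ) (b : F), algebraMap F (AlgebraicClosure k) b = x ^ q ^ m := by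
  haveI := normal_algebraicClosure_intermediateField F
  haveI : ExpChar F q := expChar_of_injective_algebraMap (algebraMap k F).injective q
  obtain ⟨m, y, hy⟩ := exists_pow_mem_range_of_forall_algEquiv (F := F)
    (L := AlgebraicClosure k) q (x := x) fun τ => by
      rw [← coe_galFixingOfAlgEquiv_smul F τ x]
      exact hx _
  exact ⟨m, y, hy⟩

/-- In characteristic `0`, an element of `K̄` fixed by `Gal(K̄/F)` lies in `F` (`K̄^{Gal(K̄/F)} = F`,
the Galois correspondence for `K̄/F`). [cite: MilneFT2022, Ch. 7, Thm. 7.12 (Krull)] -/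
theorem galFixing.exists_algebraMap_eq_of_forall_smul_eq [CharZero k]
    {x : AlgebraicClosure k} (hx : ∀ g : galFixing k F, (g : absoluteGaloisGroup k) • x = x) :
    ∃ b : F, algebraMap F (AlgebraicClosure k) b = x := by
  obtain ⟨m, b, hb⟩ := galFixing.exists_algebraMap_eq_pow_of_forall_smul_eq F 1 hx
  exact ⟨b, by rwa [one_pow, pow_one] at hb⟩

/-- **Kummer theory for `Gal(K̄/F)`, cocycle level.**  A `μₙ`-valued `1`-cocycle of `Gal(K̄/F)` —
a multiplicative cocycle `c : Gal(K̄/F) → K̄ˣ` with `cⁿ = 1` and open kernel-set — is the Kummer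
cocycle `g ↦ g • β / β` of a unit `β ∈ K̄ˣ` whose `n`-th power is `Gal(K̄/F)`-invariant (so
`βⁿ ∈ F` in characteristic `0`, `galFixing.exists_kummer_of_cocycle_charZero`).
[cite: SerreLocalFields1979, X §3 b)] -/
theorem galFixing.exists_kummer_of_cocycle (n : ℕ) (c : galFixing k F → (AlgebraicClosure k)ˣ)
    (hcoc : ∀ g h, c (g * h) = c g * (g : absoluteGaloisGroup k) • c h)
    (hopen : IsOpen {g | c g = 1}) (hn : ∀ g, c g ^ n = 1) :
    ∃ β : (AlgebraicClosure k)ˣ,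
      (∀ g : galFixing k F, (g : absoluteGaloisGroup k) • β ^ n = β ^ n) ∧
      ∀ g, c g = (g : absoluteGaloisGroup k) • β / β := by
  obtain ⟨β, hβ⟩ := galFixing.exists_eq_smul_div_of_cocycle F c hcoc hopen
  refine ⟨β, fun g => ?_, hβ⟩
  have h := hn g
  rw [hβ g, div_pow, ← smul_pow', div_eq_one] at h
  exact h

/-- Kummer theory for `Gal(K̄/F)` in characteristic `0`: a `μₙ`-valued cocycle with open kernel-set
is `g ↦ g • β / β` with `βⁿ = b ∈ F` — every class of `H¹(Gal(K̄/F), μₙ)` is the Kummer class of an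
element of `Fˣ`. [cite: SerreLocalFields1979, X §3 b)] -/
theorem galFixing.exists_kummer_of_cocycle_charZero [CharZero k] (n : ℕ)
    (c : galFixing k F → (AlgebraicClosure k)ˣ)
    (hcoc : ∀ g h, c (g * h) = c g * (g : absoluteGaloisGroup k) • c h)
    (hopen : IsOpen {g | c g = 1}) (hn : ∀ g, c g ^ n = 1) :
    ∃ (β : (AlgebraicClosure k)ˣ) (b : F),
      algebraMap F (AlgebraicClosure k) b = (β : AlgebraicClosure k) ^ n ∧
      ∀ g, c g = (g : absoluteGaloisGroup k) • β / β := by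
  obtain ⟨β, hβn, hβ⟩ := galFixing.exists_kummer_of_cocycle F n c hcoc hopen hn
  have hfix : ∀ g : galFixing k F,
      (g : absoluteGaloisGroup k) • ((β : AlgebraicClosure k) ^ n) = (β : AlgebraicClosure k) ^ n :=
    fun g => by
      have h := congrArg (fun u : (AlgebraicClosure k)ˣ => (u : AlgebraicClosure k)) (hβn g)
      simpa only [Units.coe_smul, Units.val_pow_eq_pow_val] using h
  obtain ⟨b, hb⟩ := galFixing.exists_algebraMap_eq_of_forall_smul_eq F hfix
  exact ⟨β, b, hb, hβ⟩

end Kummer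

/-! ### §3. The bundled form: continuous `1`-cocycles of the restricted Kummer module -/

section Bundled

variable (F : IntermediateField k (AlgebraicClosure k)) (n : ℕ)

/-- **Every continuous `1`-cocycle of `Gal(K̄/F)` in `μₙ` is a Kummer cocycle** — bundled form over
the tree's `contOneCocycles` of the restricted module `(mu k n).restrict (subgroupIncl (galFixing k F))`
(the currency of `KummerSES.IsSES.res` / `subsingleton_one_units_galFixing`): there is `β ∈ K̄ˣ`
with `βⁿ` invariant under `Gal(K̄/F)` and `φ g = g • β / β` in `K̄ˣ` for all `g`.
[cite: SerreLocalFields1979, X §3 b)] -/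
theorem galFixing.exists_kummer_eq_contOneCocycle
    (φ : contOneCocycles (((mu k n).restrict (subgroupIncl (galFixing k F))).toTopRep)) :
    ∃ β : (AlgebraicClosure k)ˣ,
      (∀ g : galFixing k F, (g : absoluteGaloisGroup k) • β ^ n = β ^ n) ∧
      ∀ g, muVal k n (φ.1 g) = (g : absoluteGaloisGroup k) • β / β := by
  let c : galFixing k F → (AlgebraicClosure k)ˣ := fun g => muVal k n (φ.1 g)
  have hcoc : ∀ g h, c (g * h) = c g * (g : absoluteGaloisGroup k) • c h := by
    intro g h
    have h1 := congrArg (muVal k n) (φ.2 g h)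
    rw [muVal_add] at h1
    exact h1
  have hopen : IsOpen {g | c g = 1} := by
    have h0 : {g | c g = 1} = φ.1 ⁻¹' {0} := by
      ext g
      simp only [Set.mem_setOf_eq, Set.mem_preimage, Set.mem_singleton_iff, c]
      rw [← muVal_zero k n]
      exact (muVal_injective k n).eq_iff
    rw [h0]
    exact (isOpen_discrete _).preimage φ.1.continuous
  have hn : ∀ g, c g ^ n = 1 := fun g => muVal_pow_eq_one k n _
  exact galFixing.exists_kummer_of_cocycle F n c hcoc hopen hn

/-- Bundled Kummer theory for `Gal(K̄/F)` in characteristic `0`: `φ g = g • β / β` with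
`βⁿ = b ∈ F`. [cite: SerreLocalFields1979, X §3 b)] -/
theorem galFixing.exists_kummer_eq_contOneCocycle_charZero [CharZero k]
    (φ : contOneCocycles (((mu k n).restrict (subgroupIncl (galFixing k F))).toTopRep)) :
    ∃ (β : (AlgebraicClosure k)ˣ) (b : F),
      algebraMap F (AlgebraicClosure k) b = (β : AlgebraicClosure k) ^ n ∧
      ∀ g, muVal k n (φ.1 g) = (g : absoluteGaloisGroup k) • β / β := by
  obtain ⟨β, hβn, hβ⟩ := galFixing.exists_kummer_eq_contOneCocycle F n φ
  have hfix : ∀ g : galFixing k F,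
      (g : absoluteGaloisGroup k) • ((β : AlgebraicClosure k) ^ n) = (β : AlgebraicClosure k) ^ n :=
    fun g => by
      have h := congrArg (fun u : (AlgebraicClosure k)ˣ => (u : AlgebraicClosure k)) (hβn g)
      simpa only [Units.coe_smul, Units.val_pow_eq_pow_val] using h
  obtain ⟨b, hb⟩ := galFixing.exists_algebraMap_eq_of_forall_smul_eq F hfix
  exact ⟨β, b, hb, hβ⟩

end Bundled

/-! ### §4. The trivial-action case `μₙ(K̄) ⊆ F`: continuous homomorphisms `Gal(K̄/F) → μₙ` -/

section Hom

variable (F : IntermediateField k (AlgebraicClosure k)) (n : ℕ)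

/-- **`Hom_cont(Gal(K̄/F), μₙ) = Fˣ/Fˣⁿ` at the level of homomorphisms.**  If the `n`-th roots of
unity of `K̄` lie in `F` (so `Gal(K̄/F)` acts trivially on `μₙ`), a homomorphism
`χ : Gal(K̄/F) → K̄ˣ` of exponent `n` (values in `μₙ`) with open kernel-set is a `1`-cocycle, hence
`χ g = g • β / β` for a unit `β` with `βⁿ` invariant under `Gal(K̄/F)`.
[cite: SerreLocalFields1979, X §3 b)] -/
theorem galFixing.exists_kummer_of_hom
    (hμ : ∀ ζ : (AlgebraicClosure k)ˣ, ζ ^ n = 1 → (ζ : AlgebraicClosure k) ∈ F)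
    (χ : galFixing k F → (AlgebraicClosure k)ˣ) (hmul : ∀ g h, χ (g * h) = χ g * χ h)
    (hopen : IsOpen {g | χ g = 1}) (hn : ∀ g, χ g ^ n = 1) :
    ∃ β : (AlgebraicClosure k)ˣ,
      (∀ g : galFixing k F, (g : absoluteGaloisGroup k) • β ^ n = β ^ n) ∧
      ∀ g, χ g = (g : absoluteGaloisGroup k) • β / β := by
  have htriv : ∀ (g : galFixing k F) (h : galFixing k F),
      (g : absoluteGaloisGroup k) • χ h = χ h := fun g h => by
    apply Units.ext
    rw [Units.coe_smul]
    exact (mem_galFixing_iff k).1 g.2 _ (hμ (χ h) (hn h))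
  refine galFixing.exists_kummer_of_cocycle F n χ (fun g h => ?_) hopen hn
  rw [hmul, htriv]

/-- Characteristic `0`: with `μₙ(K̄) ⊆ F`, every exponent-`n` homomorphism `χ : Gal(K̄/F) → K̄ˣ`
with open kernel-set is `g ↦ g(β)/β` with `βⁿ = b ∈ F` ("every continuous character of
`Gal(K̄/F)` of exponent `n` is a Kummer character `g ↦ g(ⁿ√b)/ⁿ√b`, `b ∈ Fˣ`").
[cite: SerreLocalFields1979, X §3 b)] -/
theorem galFixing.exists_kummer_of_hom_charZero [CharZero k]
    (hμ : ∀ ζ : (AlgebraicClosure k)ˣ, ζ ^ n = 1 → (ζ : AlgebraicClosure k) ∈ F)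
    (χ : galFixing k F → (AlgebraicClosure k)ˣ) (hmul : ∀ g h, χ (g * h) = χ g * χ h)
    (hopen : IsOpen {g | χ g = 1}) (hn : ∀ g, χ g ^ n = 1) :
    ∃ (β : (AlgebraicClosure k)ˣ) (b : F),
      algebraMap F (AlgebraicClosure k) b = (β : AlgebraicClosure k) ^ n ∧
      ∀ g, χ g = (g : absoluteGaloisGroup k) • β / β := by
  obtain ⟨β, hβn, hβ⟩ := galFixing.exists_kummer_of_hom F n hμ χ hmul hopen hn
  have hfix : ∀ g : galFixing k F,
      (g : absoluteGaloisGroup k) • ((β : AlgebraicClosure k) ^ n) = (β : AlgebraicClosure k) ^ n :=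
    fun g => by
      have h := congrArg (fun u : (AlgebraicClosure k)ˣ => (u : AlgebraicClosure k)) (hβn g)
      simpa only [Units.coe_smul, Units.val_pow_eq_pow_val] using h
  obtain ⟨b, hb⟩ := galFixing.exists_algebraMap_eq_of_forall_smul_eq F hfix
  exact ⟨β, b, hb, hβ⟩

end Hom

/-! ### §5. Closed subgroups of `Γ_k` are fixing subgroups (Krull), and the readings for them -/

section Closed

/-- **Krull's Galois correspondence inside `Γ_k`**: for `K̄/k` Galois (e.g. `k` of characteristic
`0`), a CLOSED subgroup `H ≤ Γ_k` is the fixing subgroup `Gal(K̄/K̄^H) = galFixing k (K̄^H)` of its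
fixed field (Mathlib `InfiniteGalois.fixingSubgroup_fixedField`, transported along
`absoluteGaloisGroup.toAlgEquiv : Γ_k ≃* Aut_k(K̄)`). [cite: MilneFT2022, Ch. 7, Thm. 7.12 (Krull)] -/
theorem exists_eq_galFixing_of_isClosed [IsGalois k (AlgebraicClosure k)]
    (H : Subgroup (absoluteGaloisGroup k)) (hH : IsClosed (H : Set (absoluteGaloisGroup k))) :
    ∃ F : IntermediateField k (AlgebraicClosure k), galFixing k F = H := by
  let e := absoluteGaloisGroup.toAlgEquiv k
  let H' : Subgroup (AlgebraicClosure k ≃ₐ[k] AlgebraicClosure k) := H.map e.toMonoidHom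
  have hH' : IsClosed (H' : Set (AlgebraicClosure k ≃ₐ[k] AlgebraicClosure k)) := by
    have hset : (H' : Set (AlgebraicClosure k ≃ₐ[k] AlgebraicClosure k)) = e.symm ⁻¹' H := by
      ext τ
      simp only [H', Subgroup.coe_map, MulEquiv.coe_toMonoidHom, Set.mem_preimage, SetLike.mem_coe]
      constructor
      · rintro ⟨σ, hσ, rfl⟩
        simpa using hσ
      · intro h
        exact ⟨e.symm τ, h, by simp⟩
    rw [hset]
    exact hH.preimage continuous_toAlgEquiv_symm
  refine ⟨fixedField H', ?_⟩
  have hfix : (fixedField H').fixingSubgroup = H' :=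
    InfiniteGalois.fixingSubgroup_fixedField ⟨H', hH'⟩
  ext σ
  change σ ∈ (fixedField H').fixingSubgroup.comap e.toMonoidHom ↔ σ ∈ H
  rw [hfix, Subgroup.mem_comap]
  constructor
  · rintro ⟨σ', hσ', h⟩
    have : σ' = σ := e.injective h
    rwa [← this]
  · intro h
    exact ⟨σ, h, rfl⟩

/-- **Kummer theory for a closed subgroup `H ≤ Γ_k`, cocycle level** (`K̄/k` Galois): a
multiplicative `1`-cocycle `c : H → K̄ˣ` with open kernel-set and `cⁿ = 1` is `g ↦ g • β / β` with
`βⁿ` invariant under `H`.  For `H = N_S = Gal(K̄/K_S)` (a number field `K`, `RestrictedRamification`):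
`H¹(Gal(K̄/K_S), μₙ)` consists of Kummer classes of `H`-invariant `n`-th powers, i.e. of `K_Sˣ`.
[cite: SerreLocalFields1979, X §3 b)] -/
theorem exists_kummer_of_cocycle_of_isClosed [IsGalois k (AlgebraicClosure k)] (n : ℕ)
    (H : Subgroup (absoluteGaloisGroup k)) (hH : IsClosed (H : Set (absoluteGaloisGroup k)))
    (c : H → (AlgebraicClosure k)ˣ)
    (hcoc : ∀ g h, c (g * h) = c g * (g : absoluteGaloisGroup k) • c h)
    (hopen : IsOpen {g | c g = 1}) (hn : ∀ g, c g ^ n = 1) :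
    ∃ β : (AlgebraicClosure k)ˣ,
      (∀ g : H, (g : absoluteGaloisGroup k) • β ^ n = β ^ n) ∧
      ∀ g, c g = (g : absoluteGaloisGroup k) • β / β := by
  obtain ⟨F, rfl⟩ := exists_eq_galFixing_of_isClosed H hH
  exact galFixing.exists_kummer_of_cocycle F n c hcoc hopen hn

/-- **`Hom_cont(H, μₙ)` is Kummer for a closed `H ≤ Γ_k` acting trivially on `μₙ`** (`K̄/k` Galois):
if every `σ ∈ H` fixes the `n`-th roots of unity of `K̄`, an exponent-`n` homomorphism
`χ : H → K̄ˣ` with open kernel-set is `g ↦ g • β / β` with `βⁿ` invariant under `H`.  At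
`H = N_S = Gal(K̄/K_S)` with `S ⊇ S_p`, `n = p^m` (so `μ_{p^m} ⊆ K_S`): every continuous
`χ : N_S → μ_{p^m}` is `σ ↦ σ(β)/β` with `β^{p^m} ∈ K_Sˣ` — the form consumed by the
inflation–restriction analysis of `H²(G_S, μ_{p^m})` (NSW VIII §3).
[cite: SerreLocalFields1979, X §3 b)] -/
theorem exists_kummer_of_hom_of_isClosed [IsGalois k (AlgebraicClosure k)] (n : ℕ)
    (H : Subgroup (absoluteGaloisGroup k)) (hH : IsClosed (H : Set (absoluteGaloisGroup k)))
    (hμ : ∀ ζ : (AlgebraicClosure k)ˣ, ζ ^ n = 1 →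
      ∀ σ ∈ H, σ • (ζ : AlgebraicClosure k) = ζ)
    (χ : H → (AlgebraicClosure k)ˣ) (hmul : ∀ g h, χ (g * h) = χ g * χ h)
    (hopen : IsOpen {g | χ g = 1}) (hn : ∀ g, χ g ^ n = 1) :
    ∃ β : (AlgebraicClosure k)ˣ,
      (∀ g : H, (g : absoluteGaloisGroup k) • β ^ n = β ^ n) ∧
      ∀ g, χ g = (g : absoluteGaloisGroup k) • β / β := by
  have htriv : ∀ (g : H) (h : H), (g : absoluteGaloisGroup k) • χ h = χ h := fun g h => by
    apply Units.ext
    rw [Units.coe_smul]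
    exact hμ (χ h) (hn h) _ g.2
  refine exists_kummer_of_cocycle_of_isClosed n H hH χ (fun g h => ?_) hopen hn
  rw [hmul, htriv]

/-- Characteristic-`0` reading with the fixed field made explicit: for a closed `H ≤ Γ_k` there is
a subextension `F` (namely `K̄^H`) with `Gal(K̄/F) = H`, and every exponent-`n` `1`-cocycle
`c : H → K̄ˣ` with open kernel-set is `g ↦ g • β / β` with `βⁿ = b ∈ F`:
`H¹(H, μₙ) = Fˣ/Fˣⁿ` at cocycle level. [cite: SerreLocalFields1979, X §3 b)] -/
theorem exists_kummer_of_cocycle_of_isClosed_charZero [CharZero k] [IsGalois k (AlgebraicClosure k)]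
    (n : ℕ) (H : Subgroup (absoluteGaloisGroup k)) (hH : IsClosed (H : Set (absoluteGaloisGroup k)))
    (c : H → (AlgebraicClosure k)ˣ)
    (hcoc : ∀ g h, c (g * h) = c g * (g : absoluteGaloisGroup k) • c h)
    (hopen : IsOpen {g | c g = 1}) (hn : ∀ g, c g ^ n = 1) :
    ∃ (F : IntermediateField k (AlgebraicClosure k)) (β : (AlgebraicClosure k)ˣ) (b : F),
      galFixing k F = H ∧
      algebraMap F (AlgebraicClosure k) b = (β : AlgebraicClosure k) ^ n ∧
      ∀ g, c g = (g : absoluteGaloisGroup k) • β / β := by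
  obtain ⟨F, rfl⟩ := exists_eq_galFixing_of_isClosed H hH
  obtain ⟨β, b, hb, hβ⟩ := galFixing.exists_kummer_of_cocycle_charZero F n c hcoc hopen hn
  exact ⟨F, β, b, rfl, hb, hβ⟩

end Closed

end Literature.NumberTheory.GaloisRepresentations

end
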